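import Mathlib
import HarnessLib
import HarnessLib.Audit
import Summits.FinalStateConjecture.Statement
import Literature.Geometry.Lorentzian.SelfSimilarVacuumProfile
import Literature.Geometry.Lorentzian.TangentProfile
import Literature.Geometry.Lorentzian.IdealPoints
import Literature.Geometry.Lorentzian.HomotheticSurfaceGravity
import Literature.Geometry.Lorentzian.NullConeGeneratorKinematics
import Summits.FinalStateConjecture.FinalStateConjecture.Theorems.CurvatureOrSymmetryLocalExitSuffices

/-!
Route: HomotheticSurfaceGravity

DORMANT since 2026-09-04T17:59:59Z (reconciler: no traction for 5 d (last activity statement-checked at 2026-08-30T17:15:05Z); parked, not closed — `ledger route dormant route-FinalStateConjecture-HomotheticSurfaceGravity --off` to reac) — unstaffed, not closed; items shared with open routes are served there. `ledger route dormant <id> --off` reactivates.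

# Route HomotheticSurfaceGravity — censorship conjunct via the homothetic surface gravity α ≥ 1 of
self-similar tangent profiles at a first naked point

It suffices to show X = NakedTangentProfile ∧ ProfileExit ∧ CensoredDataExit (with the shared
support MGHDExistence; the
local-to-global reparametrisation of exit families, formerly the shared support LocalExitSuffices,
is proved inline in the
deciding theorem since the 2026-08-16 cone repair). The naked half of the exceptional set is cut AT
THE TANGENT PROFILE: an admissible datum one of whose MGHDs has
incomplete sojourn-𝓘⁺ either admits a local good exit curve (tame on one fixed end, immersed at 0)
or has a first naked point P carrying a NONFLAT smooth self-similar vacuum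
tangent profile Z (NakedTangentProfile, typed over `FirstNakedPoint`, `SelfSimilarVacuumProfile`,
`IsTangentProfileAt`); and every
such pair (P, Z) forces a local good tame exit (ProfileExit). ProfileExit is where the card
homothetic-surface-gravity-naked-point-v2 is
spent: on the past cone of Z the homothetic surface gravity α = log c₀ / log μ₀ of a dilation-fixed
generator obeys the NEC law
α = 1 + ½⨍(|σ|² + Ric(L,L)) ≥ 1 (Theorem A; analytic cores filed as provable-now supports
PeriodicInaffinityLaw,
ConcaveScalingRigidity), α = 1 profiles are benign (rigidity), and for α > 1 smoothness of Z across
its cone is a tuning condition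
whose transversal exponent γ(α) = (α−1)/(2−α) organises the instability that produces the exit. The
censored half
(CensoredDataExit) is imported verbatim from the Kerr-basin routes, exactly as in route
TangentProfileCensorship.
Lean: `MGHDExistence ∧ NakedTangentProfile ∧ ProfileExit ∧ CensoredDataExit`

## Assembly
Pure logic plus one calculus step, sorry-free in glue.lean (`theorem closes (hM : MGHDExistence) (hT
: NakedTangentProfile)
(hP : ProfileExit) (hB : CensoredDataExit) : FinalStateConjecture`, axioms propext,
Classical.choice, Quot.sound; native audit
`closes[route]: OK`). RE-TYPED 2026-08-16 for the revised Statement (p126844: tame genericity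
`IsTameChristodoulouGeneric` on ONE
fixed end, honest near-zone radii inside `HasExhaustiveCharts`, intrinsic lower bound
`RaysStayInClosure`, chart time orientation
`IsFutureOriented`): the three exit-shaped cruxes ProfileExit / NakedTangentProfile /
CensoredDataExit were restated 1:1 (same decl
names) so that every exit family is TAME on one fixed asymptotically flat end e of X (jointly
smooth; e the sole end; every member
DR-flat on e with a continuous mass M(c); `wDist`-continuous at c = 0) and IMMERSED at c = 0, and so
that "good" is the re-typed P
(MGHD exists; every MGHD has complete 𝓘⁺ and a sub-extremal Kerr final-state decomposition d of O =
exteriorOf with every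
future-complete normalised null ray from Σ staying in closure O, exhaustive honest charts and
future-oriented chart time); the
hypothesis of CensoredDataExit negates the same re-typed settling clause. Fix X and an exceptional
admissible D; a LOCAL TAME exit
suffices — a tame immersed injective admissible family whose members with 0 < ‖c‖ < ε are good is
reparametrised by the squashing
map σ c = (ε/2·arctan c₀)e₀ of ℝ¹ (smooth, injective, σ 0 = 0, ‖σ c‖ < ε, dσ(0) = (ε/2)·id) to one
all of whose members with
c ≠ 0 are good: precomposition with σ keeps joint smoothness, the sole end, the mass function M ∘ σ,
the same-end decay and the
`wDist`-continuity at 0, and immersion at 0 survives by the chain rule because dσ(0)v ≠ 0 for v ≠ 0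
(this step was the shared
support item LocalExitSuffices, stmt-FinalStateConjecture-9938, until the 2026-08-16 cone repair
inlined it; its tame form is
~110 lines of calculus inside `closes`); if every MGHD of D has complete 𝓘⁺ then MGHDExistence gives
an MGHD, exceptionality gives
a non-settling MGHD and CensoredDataExit the exit; otherwise some maximal 𝒟 has incomplete 𝓘⁺ and
NakedTangentProfile gives either
the exit directly or (P, Z), to which ProfileExit applies. Unfolding `IsTameChristodoulouGeneric` /
`HasTameCodimAtLeastIn` is
definitional. The `Assembly` item `MGHDExistence → NakedTangentProfile → ProfileExit →
CensoredDataExit → FinalStateConjecture`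
is proved verbatim by `closes`.

Rationale: WHY THIS LINE. Mechanism (card homothetic-surface-gravity-naked-point-v2, graded new-combination,
elegance high): a self-similar singularity cannot
red-shift its own past cone — along a dilation-invariant generator γ₀ (one exists by Lefschetz on
the sphere of generators) the
affine contraction c₀ and the screen contraction μ₀ per period satisfy c₀ = μ₀^α with α = 1 +
½⨍(|σ_n|² + Ric(n,n)) dτ ≥ 1 in the
area-time gauge θ_n ≡ −2 (Raychaudhuri + NEC + periodicity; equality iff γ₀ is shear- and
flux-free), so every genuine naked profile
carries a quantified blue-shift α − 1 > 0, which three literatures computed separately as RSR's κ =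
(α−1)/2 (arXiv:1912.08478 Lemma
3.3), Christodoulou's k² = α − 1 and Martín-García–Gundlach's ⟨a²⟩ = α (arXiv:gr-qc/0304070 §3.3),
with one transversal Frobenius
exponent γ(α) = (α−1)/(2−α) reproducing the printed Hölder indices and Harada–Maeda's kink law
e^{(8πκ²−1)T} (arXiv:gr-qc/0311014
§2.3, read: the s = 1 rung of "a C^{1,s} seed grows iff s < γ(α)"). Imported areas:
null-hypersurface kinematics (Raychaudhuri
focusing, as in the Penrose singularity theorem) for the sign law; Floquet/Frobenius analysis at the
regular singular point of the
similarity equations (critical-collapse renormalisation group, arXiv:gr-qc/9409035 App.,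
GundlachMartingarcia2007) for the ladder;
a topological fixed-point theorem to place the invariant generator. What it does that route
TangentProfileCensorship (same spine,
shared CensoredDataExit/MGHDExistence) does not: it types the naked exit at the profile (two cruxes
over the landed
vocabulary instead of one monolithic NakedDataExit), deletes the α = 1 class by a theorem rather
than by spectral work, and replaces
"certify an unstable mode profile by profile" by one invariant deciding which profiles need it and
at which regularity; the
negatives index is empty, nothing refuted is reused.

RANKED CRUXES. #2 ProfileExit (crux) — PROFILE EXIT (card K1 + K2 + P1, host of the α-analysis): for
every connected Hausdorff second-countable 3-manifold X, every admissible datum D, every maximal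
vacuum Cauchy development 𝒟 of D, every first naked point P of 𝒟 and every NONFLAT smooth (C^∞
across its cone) self-similar vacuum profile Z which is a C² tangent profile of 𝒟 at P (marked past
= the past of Z's vertex), there are ONE asymptotically flat end e of X, a one-parameter admissible
family F through D which is TAME on e and IMMERSED at c = 0 (re-type 2026-08-16, p126844:
`IsTameDataFamily e 1 F ∧ IsImmersedAtZero 1 F`), injective, and ε > 0 such that F c is good in the
re-typed sense (MGHD exists; every MGHD has complete 𝓘⁺ and a sub-extremal Kerr final-state
decomposition d of O = exteriorOf with `RaysStayInClosure`, honest-radii `HasExhaustiveCharts d` and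
`IsFutureOriented d`) for 0 < ‖c‖ < ε. [difficulty: open-problem] (why it might fail: Mild profiles
(1<α<2) tangent to smooth data may be smoothly STABLE (Zheng arXiv:2605.16235: C^(1,γ(α)) stability
of the k-family, a class containing smooth perturbations); tuning need not create a growing mode
(Harada's naked attractor); infinitely many naked points defeat one exit.) [arXiv:1912.08478,
arXiv:2605.16235, arXiv:2605.16095, arXiv:2402.00062, arXiv:2401.02003, arXiv:gr-qc/0311014,
arXiv:gr-qc/9807038, Christodoulou1999instability, An2025]
#3 NakedTangentProfile (crux) — EXIT-LESS NAKED DATA HAVE NONFLAT SELF-SIMILAR TANGENT PROFILES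
(card K3; typed form of the extraction step shared in content with TangentProfileCensorship's
informal TangentProfileExtraction): for every X, admissible D and maximal vacuum Cauchy development
𝒟 of D with INCOMPLETE future null infinity (sojourn form), either there is a local good exit family
through D, tame on one fixed end and immersed at 0 (literally ProfileExit's re-typed conclusion), or
𝒟 has a first naked point P (TIP, visible from infinity, minimal) and a nonflat smooth self-similar
vacuum profile Z which is a C² tangent profile of 𝒟 at P. [difficulty: open-problem] (why it might
fail: Type-II (faster than self-similar) concentration or a non-regular past cone gives no C²
self-similar tangent profile, and no exit is known there; accumulating singular ideal points leave
no minimal TIP (no FIRST naked point); C² convergence across the cone may fail (kinked limits).)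
[arXiv:1912.08478, arXiv:1705.09674, arXiv:2205.11715, arXiv:2412.09540, MorganTian2007]
#4 CensoredDataExit (crux) — CENSORED DATA EXIT (imported from the Kerr-basin routes; until the
re-type identical to TangentProfileCensorship.CensoredDataExit = stmt-FinalStateConjecture-9936,
shared by signature with CurvatureOrSymmetry / NoVacuumStrings / TangentProfileCensorship; RESTATED
here 2026-08-16 for the revised Statement p126844 — the sibling routes re-attach by normalised
signature when they re-type): for every X and every admissible D which has an MGHD, all of whose
MGHDs have complete 𝓘⁺, but some MGHD of which carries no sub-extremal Kerr final-state
decomposition d of O = exteriorOf with `RaysStayInClosure`, `HasExhaustiveCharts d` (honest radii)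
and `IsFutureOriented d` — the negation of the re-typed settling clause —, there are one
asymptotically flat end e of X, a one-parameter admissible family F through D tame on e and immersed
at 0, injective, and ε > 0 with F c good (re-typed sense) for 0 < ‖c‖ < ε. [difficulty:
open-problem] (why it might fail: Needs Kerr stability for LARGE censored data (printed only for
|a|/M ≪ 1, arXiv:2104.11857) and non-genericity of extremal or infinitely-many-hole end states
(extremal horizons form from regular data, arXiv:2211.15742); a fractal threshold accumulating at D
has no exit curve.) [DafermosLuk2017, KlainermanSzeftel2023, GiorgiKlainermanSzeftel2022,
DafermosHolzegelRodnianskiTaylor2021, KehleUnger2025, AngelopoulosKehleUnger2024]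
#9 MGHDExistence (crux since the 2026-08-16 cone repair, formerly support, rank 9 kept; re-kinded
because it is a HYPOTHESIS of the deciding theorem and the gate's glue lint admits only crux items
there — glue.non-crux-hypothesis — exactly as route MergerLatticeBudget badges the same shared item)
— every admissible datum has a maximal globally hyperbolic vacuum development over the repaired
structure `VacuumCauchyDevelopment` (Choquet-Bruhat–Geroch 1969 Thm 3; Sbierski 2016 Thm 2.6);
identical to TangentProfileCensorship.MGHDExistence (shared by signature). [why it might fail: known
in print, but typed over the REPAIRED prelude — `IsMaximal` asks EVERY typed vacuum Cauchy
development (O'Neill `IsCauchyHypersurface`, instance-bound `∀ [HasLeviCivita]`, one universe) to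
embed, so any rogue development the typing admits kills it, as happened to the first rendering
`choquetBruhat_geroch_exists_mghd` over the uninhabited `VacuumDevelopment`
(CauchyProblemExistenceDefect, `VacuumDevelopment.isEmpty`); XL to discharge.] It is VERBATIM the
named fact `Literature.Geometry.Lorentzian.choquetBruhat_geroch_exists_mghd_cauchy`
(CauchyProblemMGHDExistence.lean, undischarged, XL; order-theoretic frame landed in
CauchyProblemMGHDExistenceProofs.lean) restricted to admissible data — closed the day that fact is
discharged by `exact h.forall_mem_admissibleVacuumData` (AdmissibleMGHDExistence.lean) — and is
deliberately stated INLINE over prelude definitions so that the fact's module stays out of this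
route's import cone: the summit-wide MGHD debt is carried by this shared item, not by the cone
guardrail. [difficulty: XL] [ChoquetBruhatGeroch1969CMP, Sbierski2016AHP, Ringstrom2009]
(Dropped 2026-08-16, cone repair: the former shared support #9 LocalExitSuffices — LOCAL EXIT
SUFFICES, stmt-FinalStateConjecture-9938, PROVED by
`Summit.FinalStateConjecture.FinalStateConjecture.Theorems.LocalExitSuffices_proof` (module
Theorems/CurvatureOrSymmetryLocalExitSuffices.lean) @ 00fcba88798a — is no longer an item of THIS
route: the gate's `LocalExitSuffices_holds` link imported that Theorems file, which imports
`Theorems.PhotonSphereChannelsTameCensorshipReduction`, whose import cone carries the undischarged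
named facts `choquetBruhat_geroch_exists_mghd_cauchy` (via AdmissibleMGHDExistence) and the
refuted-FALSE `Minkowski.isCauchySurface_range_sliceEmbed` (via
TameCensorship/Negative/ExistentialContent → ModelData;
`MinkowskiCauchyDefect.not_isCauchySurface_range_sliceEmbed`), so the route was `blocked-by-cone`
for every prover although its own theses are fact-free. The reparametrisation (squashing map of ℝ¹;
since the 2026-08-16 re-type in its TAME form — tameness and immersion survive σ, ~110 lines of
calculus) is proved inside `closes`; the item keeps its other routes.)
#9 PeriodicInaffinityLaw (support) — THEOREM A, ANALYTIC CORE (i) — the affine clock of a periodic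
inaffinity: for T > 0, f ≥ 0 continuous and T-periodic (f = |σ_n|² + Ric(n,n) along the invariant
generator in area time τ, θ_n ≡ −2) and Ψ with Ψ' = −1 − f/2 (Raychaudhuri at θ ≡ −2 gives the
inaffinity κ_n = −1 − f/2), put α := 1 + (∫₀ᵀ f)/(2T); then α ≥ 1, α = 1 iff f ≡ 0, e^Ψ is
integrable on every [τ, ∞) (the vertex is at finite affine distance S(τ) = ∫_τ^∞ e^Ψ) and S(τ + T) =
e^(−αT) S(τ) (affine contraction c₀ = μ₀^α per period, μ₀ = e^(−T)). [difficulty: provable-now]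
[arXiv:1912.08478, arXiv:gr-qc/0304070, HawkingEllis1973]
#9 ConcaveScalingRigidity (support) — THEOREM A, GAUGE-FREE FORM (ii): if ρ is concave and positive
on (−ε, 0) with ρ(u) → 0 as u → 0⁻ (ρ = √A along the invariant generator in an affine parameter u
vanishing at the vertex; concavity is Raychaudhuri + NEC, (√A)'' = −½(|σ|² + Ric(L,L))√A ≤ 0) and
ρ(c·u) = μ·ρ(u) on (−ε, 0) for constants 0 < c < 1, 0 < μ (the contraction Φ⁻¹ acts by u ↦ cu on the
generator and by A ↦ μ²A on the area density), then c ≤ μ (i.e. α = log c/log μ ≥ 1 when μ < 1), and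
μ = c forces ρ(u) = a·(−u) on (−ε, 0) (shear- and flux-free generator). [difficulty: provable-now]
[arXiv:2601.04152, HawkingEllis1973, arXiv:1912.08478]
#5 TransversalExponentLadderR (crux, informal; repaired 2026-08-16 from stmt-11724,
refuted-misstated at typing level, core surviving) — the transversal exponent ladder LOCALISED at
the periodic generator γ₀: tuning for 1 < α(γ₀) < 2 (free Frobenius branch of similarity weight 2−α;
none for α > 2), interior-regular smooth growing mode for tuned smooth profiles, rough C^(1,s) seeds
grow at rate (α−1) − s(2−α). [difficulty: open-problem] (why/sources on the item)
#6 BenignProfileRigidityR (crux, typed; repaired 2026-08-16 from stmt-11734 after the refuter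
crux-attack CruxAttack-11734.md, refuted-misstated: the informal item never constrained Z.dilation —
Φ := Φ₀∘parity has no invariant generator, and deleting the Φ-fixed generators gave a
hypothesis-preserving sub-profile with none) — BENIGN PROFILES ARE NOT FIRST-NAKED, the refuter's C′
verbatim: hypotheses of ProfileExit (Z nonflat, C^∞ across its cone, C² tangent profile at the first
naked point P) plus a COMPLETE vertex past cone (Z.cone ≃ₜ S² × ℝ by maximal normalised
future-directed generators with vertex end at u = 0) ⇒ for some k ≥ 1 some k-PERIODIC normalised
generator γ ((Φ⁻¹)^[k](γ u) = γ(cu), 0 < c < 1) is blue-shifted, α_k(γ) = log c / (½∫_{−1}^{−c}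
θ_{γ'}) > 1 (k = 1: literally `homotheticSurfaceGravity`). [difficulty: open-problem] (why it might
fail: far-sector benign profiles or a Fefferman–Graham-type conical vertex may be first-naked with α
= 1 at every periodic generator; α read on 𝒩 is blind to the far sector.) [arXiv:1912.08478,
arXiv:1705.09674, arXiv:2205.11715, arXiv:2412.09540, arXiv:0710.0919]
#7 PeriodicShearRigidity (crux, typed; the intrinsic 𝒟-free core of #6, filed on the refuter's
recommendation) — SHEAR-FREENESS SPREADS FROM THE PERIODIC GENERATORS: smooth profile, complete
cone, generator field F of Z.cone; |σ_F|² = 0 along every k-periodic normalised generator (all k ≥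
1) ⇒ |σ_F|² ≡ 0 on Z.cone (Fefferman–Graham type at the cone); by Theorem A the hypothesis reads
'α_k = 1 at every periodic generator'. [difficulty: XL] (why it might fail: twisted smooth DSS — Φ^k
fixes only the zeros / commensurate closed orbits of the return map; propagation printed only for
untwisted CSS, RSR Prop 2.6, Prop 2.7 'Proof. Omitted'.) [arXiv:1912.08478, arXiv:1705.09674,
arXiv:2205.11715, Galloway2000, arXiv:0710.0919]

TWO-LAYER PLAN. Foreseen glued split of ProfileExit (k = 3, depth 1), children filed as top-level
items until the split is installed at tenure:
ProfileExit ⇐ BenignProfileRigidityR → TransversalExponentLadderR → ModeToExit → ProfileExit (the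
benign child supplies, for a cone-complete tangent
profile at a first naked point, a periodic generator with α > 1; the ladder turns α > 1 plus
smoothness across the cone into an interior-regular
smooth growing mode; ModeToExit transports the mode to an admissible exit landing in the good set).
REPAIR 2026-08-16 (refuter crux-attacks on the
informal stmt-11724 / stmt-11734, both refuted-misstated at typing level with the cores surviving;
11724 → TransversalExponentLadderR by the sibling
repair seat, 11734 → BenignProfileRigidityR + PeriodicShearRigidity here): (a) generators are
quantified as PERIODIC (Φ^k-invariant; α is
iterate-invariant by `log_pow_div_log_pow`), because Φ may act on the generator sphere without a
fixed point (dilation∘parity) — a period ≤ 2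
generator exists by Lefschetz once the cone is complete; (b) the benign child carries the hypothesis
CONE-COMPLETE (generator space ≃ S², every
generator maximal with vertex end at u = 0), which kills the Φ-equivariant sub-profile surgery
deleting the fixed generators; cone-completeness is
NOT yet a hypothesis of ProfileExit nor a conclusion of NakedTangentProfile — when the split is
installed the tenure planner either threads
`cone-complete` (or, sharper, `blue-shifted: some periodic generator has α > 1`) into
NakedTangentProfile's ∃Z and ProfileExit's ∀Z (the deciding
theorem re-glues by threading one conjunct; supersede, never reword in place), or adds a completion
child; (c) the informal proof sketch of the
benign child ('α = 1 at all periodic generators ⇒ shear-free cone ⇒ Fefferman–Graham class ⇒ regular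
vertex, never first-naked') is split
honestly into: Theorem A, equality case (HomotheticSurfaceGravityLaw over PeriodicInaffinityLaw /
ConcaveScalingRigidity: α ≥ 1, and α = 1 iff
the periodic generator is shear- and Ric(L,L)-free) + PeriodicShearRigidity (#7: intrinsic
propagation to the whole complete cone) + an UNFILED
dynamical exclusion 'a smooth cone-complete profile whose cone is shear-free (Fefferman–Graham type)
is never a C² tangent profile at a first
naked point of admissible data' — RSR expect no non-trivial FG interior in 3+1 (arXiv:1912.08478 p.
9 fn), but far-sector benign profiles (flat on
a sector around 𝒩, CSS vacuum radiation beyond a Φ-invariant null hyperplane, curvature ~ scale⁻²)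
plausibly exist AS PROFILES (refuter finding
I, linear level immediate, nonlinear small-data unprinted), so this step is Type-II-like, uses
admissibility, and belongs with the extraction
crux; it is deliberately not filed as a third layer. ModeToExit (support, informal: transport +
quantisation + basin landing, shared in content with TangentProfileCensorship's
SmoothProfileInstability / NakedPointQuantisation) and HomotheticSurfaceGravityLaw (support,
informal: Theorem A over the landed structure, to be
stated over periodic generators with D4) as before.
NakedTangentProfile is not split here (TangentProfileCensorship's TangentProfileExtraction programme
owns it; identical children will be shared by
signature).

KILL CRITERIA. ProfileExit refuted — a smooth self-similar vacuum profile tangent to smooth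
admissible naked data through which NO admissible curve
exits (a vacuum, smooth-class version of Zheng's threshold stability) — closes the route
`refuted:ProfileExit` and wounds every
censorship-spined route. TransversalExponentLadderR refuted in the regime 1 < α < 2 (a tuned,
smooth-mode-STABLE naked profile with
non-integer γ(α)) kills the card's mechanism: close `refuted` unless the α ≥ 2 branch alone still
serves ProfileExit (it does not:
pivot impossible, close). BenignProfileRigidityR refuted (a cone-complete BENIGN profile —
far-sector, or a Fefferman–Graham-type conical vertex —
tangent at a first naked point of admissible data with α = 1 at every periodic generator) ⇒ drop the
α = 1 shortcut: the benign class
must then be carried by NakedTangentProfile's direct-exit disjunct (a Type-II-like exclusion), no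
structural damage to the α > 1 line.
PeriodicShearRigidity refuted (a smooth cone-complete DSS vacuum profile, shear-free along all its
periodic generators but sheared
elsewhere on the cone) ⇒ the invariant α is blind to part of the cone; BenignProfileRigidityR loses
its mechanism and is dropped likewise
(the route survives on NakedTangentProfile ∧ ProfileExit with the benign class inside the extraction
step). NakedTangentProfile refuted (exit-less naked datum with Type-II blow-up) ⇒ pivot to a Type-II
branch or close; CensoredDataExit
refuted ⇒ the typed summit is false (as for TangentProfileCensorship). NakedDataExit proved inside
TangentProfileCensorship by other
means supersedes NakedTangentProfile ∧ ProfileExit (close `superseded`).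

NOT DECOMPOSED YET. The Raychaudhuri identity along generators of a level-set null cone and the
Jacobi area density (formalisation behind
HomotheticSurfaceGravityLaw; definition request D1); the Lefschetz/Poincaré–Hopf fixed generator and
the twisted-DSS case of the
rigidity (shear-freeness off γ₀); the Frobenius analysis at the cone for the linearised vacuum
operator without symmetry; transport
of a growing mode through the constraint equations to admissible data on X and the one- vs two-sided
exit; finiteness of first naked
points; Kerr-basin landing of exit data; everything inside CensoredDataExit. All are layer-2
children or `--supports` lemmas later. For the repaired
benign branch (2026-08-16): Z.cone = ∂(Z.past) and Φ(Z.cone) = Z.cone (dv ≠ 0 on the cone plus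
`image_dilation_closure_past`); homotheties
carry maximal normalised generators to maximal normalised generators
(`existsUnique_isMaximalGeodesicOn`, `IsGeodesicOn.comp_affine`,
connection naturality), so that a complete cone yields a return homeomorphism φ of S² and, by
Lefschetz (L(φ) = 1 + deg φ, or φ² when
deg φ = −1), a periodic generator of period ≤ 2 with 0 < c < 1 (c < 1 from the vertex axiom);
independence of '|σ|² = 0' from the generator
field (σ_{fn} = fσ_n); the far-sector / Fefferman–Graham-vertex exclusion of the TWO-LAYER PLAN
(unfiled, dynamical).

CHEAPEST FALSIFIER. ODE level, one kit job or an afternoon with print: take the spherically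
symmetric CSS Einstein–scalar solutions with regular centre
AND analytic similarity horizon (Brady class, arXiv:gr-qc/9409035; Harada–Maeda arXiv:gr-qc/0311014
§4, BCGN solutions) — compute
α = 1 + 4πκ² and the smooth-mode spectrum of each: a naked-vertex member with 1 < α < 2, γ(α) ∉ ℕ
and NO growing smooth mode kills
TransversalExponentLadderR (hence the mechanism). Done so far: HM §2.2–2.3 read (pp. 5–6: g/ḡ = 1 +
4πκ² at the horizon, transluminal
iff 4πκ² < 1, kink unstable iff 4πκ² > 1/2 — consistent with γ(α) = 1 at α = 3/2); §4 not yet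
evaluated; Harada gr-qc/9807038 §4.1
(naked fluid attractor: m/R → 0 on the first null ray, α ≈ 1) does not fire the falsifier but flags
the benign/attractor tension for
BenignProfileRigidity in matter models. For PeriodicShearRigidity the cheapest probe is the
axisymmetric twisted ansatz: linearise the self-similar vacuum
equations at the flat (or a Fefferman–Graham) cone in a Φ-adapted double-null gauge with return map
= rotation of the generator sphere,
impose C^∞ across the cone, and check whether shear data vanishing on the two polar (fixed)
generators is forced to vanish identically.

NUMBERS. Christodoulou k-family: α = 1 + k², 0 < k² < 1/3, data C^(1,k²/(1−k²)) = C^(1,γ(α)) at the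
cone; Zheng/Singh–Zheng stability in
C^(1,γ(α))_loc for k² ≪ 1 (arXiv:2605.16235 Thm 1.3). RSR vacuum: α = 1 + 2κ, g ∈ C^N ∩ C^(1,cε²)
across v̂ = 0 (arXiv:1912.08478
Thm 1). Harada–Maeda CSS scalar: similarity horizon transluminal iff 4πκ² < 1 (α < 2); kink law δj'
∝ e^((8πκ²−1)T), unstable iff
4πκ² > 1/2 (α > 3/2, γ(α) > 1); flat Friedmann 4πκ² = 1/3 (α = 4/3, γ = 1/2). Choptuik: Δ ≈ 3.44,
one unstable mode, Ū₀² > 1/2 on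
the past cone (arXiv:gr-qc/0304070 §3.3; α > 2 in the card's dictionary). Harada naked perfect-fluid
attractor: k ≲ 0.0105, m/R → 0 on
the first null ray (α ≈ 1). Items at open: 8 typed (3 cruxes, 4 supports of which 2 provable-now, 1
assembly) + 4 informal to file (2 cruxes, 2 supports) = 12 ≤ 15. After the 2026-08-16 repairs (11724
→ TransversalExponentLadderR, informal crux r5; 11734 → BenignProfileRigidityR r6 +
PeriodicShearRigidity r7, both typed): 13 items (6 cruxes ranked 2–7, 6 supports, 1 assembly) ≤ 15.
After the 2026-08-16 CONE REPAIR (LocalExitSuffices dropped, local-exit step inlined into `closes`,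
Assembly restated without it; MGHDExistence re-kinded support→crux (rank 9) for the crux-only glue
lint): 12 items (7 cruxes: ranks 2–7 and 9; 4 supports; 1 assembly) ≤ 15 — seven cruxes is the cap,
but the rank-9 one is the summit-wide shared MGHD item, not a new burden of this line. After the
2026-08-16 STATEMENT RE-TYPE (p126844, route-repair seat be711c71): ProfileExit,
NakedTangentProfile, CensoredDataExit restated 1:1 under the same decl names (tame immersed exit
families on one fixed end; re-typed good/settling clause with RaysStayInClosure, honest-radii
HasExhaustiveCharts, IsFutureOriented), `closes` re-elaborated with the tame squash (Sketch rc 0,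
axioms standard), counts unchanged: 12 items (7 cruxes, 4 supports, 1 assembly); import cone =
Statement + SelfSimilarVacuumProfile, TangentProfile, IdealPoints, HomotheticSurfaceGravity,
NullConeGeneratorKinematics, with NO undischarged named fact. CONE HYGIENE for provers of this
route: a Theorems file that closes one of its items is imported INTO the route file by the gate's
`_holds` link, together with its whole import cone — import only this route file (or Literature
modules free of undischarged named facts; in particular nothing reaching `ModelData`,
`CauchyProblem`, `AdmissibleMGHDExistence`, `CauchyProblemMGHDExistence`, `Stability`,
`KerrStationaryBlackHole`), and re-prove small helpers (e.g. `PhotonSphereChannels.squash_spec` /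
`isSmoothDataFamily_comp`) locally rather than importing a reduction file of another route; one
dirty import re-blocks the whole route.

DEFINITION REQUESTS. D1 `NullConeGeneratorKinematics` (topic Literature/Geometry/Lorentzian): for a
smooth null hypersurface given as a regular level set
with null generator field L (the shape of `SelfSimilarVacuumProfile.cone`): generators as null
geodesics, the Jacobi area density A
and expansion θ = L(log A), shear norm and inaffinity of a generator field along a generator, with
the Raychaudhuri identity
L θ = κθ − θ²/2 − |σ|² − Ric(L,L) (bridge to the leafwise `NullHypersurface.expansion` of
HawkingMassFlux). D2 `homotheticSurfaceGravity`
(topic Summits/FinalStateConjecture/FinalStateConjecture/Theorems, new object): for Z :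
SelfSimilarVacuumProfile n and a
dilation-invariant generator γ₀ ⊆ Z.cone, the affine contraction c₀ of Z.dilation.symm on γ₀ (vertex
end at finite affine
parameter), the area-density contraction μ₀, and α(γ₀) := log c₀ / log μ₀. D3 (noted, owned by
TangentProfileCensorship's D3/D4):
homothety-adapted charts linking Z to `MetricCoord.HasSmoothUnstableMode`. Filed with `ledger
workitem add --kind definition` after
open, `--for` the informal items. D4 (filed 2026-08-16 with the
repair of 11734; topic Literature/Geometry/Lorentzian, extending HomotheticSurfaceGravity.lean):
`SelfSimilarVacuumProfile.IsPeriodicGenerator Z k γ`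
(IsInvariantGenerator with (Φ⁻¹)^[k]), the iterated contractions and `homotheticSurfaceGravityIter`
(α_k; α_k = α on invariant generators,
`log_pow_div_log_pow`), and `SelfSimilarVacuumProfile.IsConeComplete Z` (generator-sphere
trivialisation Z.cone ≃ₜ S² × ℝ by maximal normalised
future-directed generators with vertex end at u = 0); BenignProfileRigidityR and
PeriodicShearRigidity inline these clauses verbatim, so the
named forms are definitional rewrites (an `Iff.rfl`-level bridge), not restatements.

Novelty: Searches (2026-08-15): `lit search --hybrid "surface gravity homothetic horizon self-similar"` (8
book hits, Stephani et al. 2003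
pp. 192–194 homothetic motions, Wald 1984 — no cone invariant; FTS leg rc 75); `lit search --source
crossref "homothetic Killing horizon
surface gravity"` (8: doi:10.1063/1.523943 Dyer–Honig 1979, doi:10.1088/0264-9381/18/23/315,
doi:10.1088/1361-6382/addea3 — notions of
homothetic/Killing horizons only); `lit search --source arxiv "stability criterion self-similar
solutions kink"` (3: gr-qc/0109042,
gr-qc/0311014 READ pp. 5–6, astro-ph/0504451); `lit frontier FinalStateConjecture --since 2024` (30:
arXiv:2409.14582, 2601.04152,
2601.01517 — exits/trapped surfaces, no cone invariant); `lit galaxy search "self-similar naked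
singularity" --star all` (0) and
`"homothetic Killing horizon" --star all` (1, irrelevant); searchd rc 75 ×2 and arXiv HTTP 429 ×2
logged; plus the card's audited
searches (refuter g3, 2026-08-15: HM §2.2–2.3 and Brady App. read; Theses grep).
Nearest prior art found: arXiv:gr-qc/0311014 §2.2–2.3 (spherical CSS scalar field: g/ḡ = 1 + 4πκ² at
the similarity horizon is the
spherical α; kink law = the s = 1 rung of the ladder); arXiv:gr-qc/9409035 Appendix (free Frobenius
constant iff 4πκ² < 1 = the
α = 2 tuning threshold); arXiv:1912.08478 Prop 2.7 + Lemma 3.3 (κ = (α−1)/2 and the α = 1 rigidity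
in CSS vacuum);
arXiv:gr-qc/0304070 §3.3 (⟨a²⟩, ε); route TangentProfileCensorship (same spine, no invariant,
monolithic NakedDataExit).  [refs: 10.1063/1.523943, 10.1088/0264-9381/18/23/315, 10.1088/1361-6382/addea3, 2409.14582, gr-qc/0311014, gr-qc/9409035, 1912.08478, gr-qc/0304070, doi:10.1063/1.523943, doi:10.1088/0264-9381/18/23/315, doi:10.1088/1361-6382/addea3]

Barriers (technique_class: null-cone-kinematics, self-similar-blowup, holder-ladder): - technique_class: null-cone-kinematics, self-similar-blowup, holder-ladder
- Literature.Barriers.FinalStateConjecture.nakedSingularityInstability: evaded on both counts — (α)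
no counterexample to the GENERIC statement is drawn (the route proves positive codimension curve by
curve, `IsTameChristodoulouGeneric … 1` shape: tame immersed exit families on one fixed end); (β)
genericity-aware by construction (NakedTangentProfile/ProfileExit quantify over exceptional data and
output exit families). Its scope caveats (b)/(h) (regularity dependence: Singh2024, Zheng
arXiv:2605.16235, Li2025) are the route's organising variable, not an obstacle: the rough blue-shift
channel at Hölder index s is claimed open iff s < γ(α) and is never used on smooth data;
smooth-class instability is claimed only for tuned profiles and only as a crux.
- Literature.Barriers.FinalStateConjecture.IonescuKlainermanNonExtension: not met — no Killing or
homothetic field is extended across a horizon; the homothety is a property of the blow-up limit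
asserted by NakedTangentProfile and α is read on that limit's own cone.
- Literature.Barriers.FinalStateConjecture.KehrbergerLogarithmicAsymptotics: not met — completeness
of 𝓘⁺ is Christodoulou's intrinsic sojourn notion (`HasCompleteNullInfinity`), no conformal
compactification or peeling is used; the analysis is local to the past cone of the first naked
point.
- Literature.Barriers.FinalStateConjecture.SlowlyRotatingKerrFrontier: it does not evade it; the
exposure

History (route lifecycle, newest last):
- 2026-08-16T03:07:29Z · rev 5: dropped TransversalExponentLadder — repair: drop the misstated informal crux TransversalExponentLadder (stmt-FinalStateConjecture-11724; refuter crux-attack 2026-08-16, refuted-misstated at typing (planner-rrefute-FinalStateConjecture-Homotheti-2b61087f-0)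
- 2026-08-16T03:11:33Z · rev 6: dropped TransversalExponentLadderR — repair, same session: withdraw my first restatement TransversalExponentLadderR (stmt-FinalStateConjecture-14136, unvetted, filed 03:04Z) in favour of a sharper (planner-rrefute-FinalStateConjecture-Homotheti-2b61087f-0)
- 2026-08-16T20:49:56Z · rev 12: restated Assembly (stmt-FinalStateConjecture-11669) — cone repair (route-repair seat 2026-08-16): drop the proved shared support LocalExitSuffices (stmt-FinalStateConjecture-9938) from THIS route, restate Assembly (planner-rrepair-FinalStateConjecture-Homotheti-83df192b-0)
- 2026-08-16T20:49:56Z · rev 12: dropped LocalExitSuffices — cone repair (route-repair seat 2026-08-16): drop the proved shared support LocalExitSuffices (stmt-FinalStateConjecture-9938) from THIS route, restate Assembly (planner-rrepair-FinalStateConjecture-Homotheti-83df192b-0)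
- 2026-08-16T23:16:51Z · rev 15: restated ProfileExit (stmt-FinalStateConjecture-11665), NakedTangentProfile (stmt-FinalStateConjecture-11666), CensoredDataExit (stmt-FinalStateConjecture-9936) — route-repair (statement re-typed p126844, 2026-08-16T21:19Z): restate 1:1 the three exit-shaped cruxes ProfileExit (11665), NakedTangentProfile (1166 (planner-rrepair-FinalStateConjecture-Homotheti-be711c71-0)
- 2026-08-24T05:55:44Z · DORMANT — reconciler: no traction for 6.6 d (last activity item-evidence-added at 2026-08-17T15:45:33Z); parked, not closed — `ledger route dormant route-FinalStateConjec (operator:999:3505198)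
- 2026-08-30T17:06:14Z · REACTIVATED (open) — reconciler: reactivated — activity statement-checked at 2026-08-30T15:54:01Z after parking at 2026-08-24T05:55:44Z (operator:999:405282)
- 2026-09-04T17:59:59Z · DORMANT — reconciler: no traction for 5 d (last activity statement-checked at 2026-08-30T17:15:05Z); parked, not closed — `ledger route dormant route-FinalStateConjecture (operator:999:1783472)

sub-problem: FinalStateConjecture · status: dormant · opened planner-plancard-FinalStateConjecture-FinalSt-5b5474aa-0 2026-08-15T18:34:32Z · rev 17 · ledger route-FinalStateConjecture-HomotheticSurfaceGravity
GENERATED by the gate from the ledger (D-0016/17). Provers cite these decls: `theorem foo : Summit.FinalStateConjecture.FinalStateConjecture.Theses.HomotheticSurfaceGravity.<Decl> := …` in Summits/FinalStateConjecture/FinalStateConjecture/Theorems/<Name>.lean.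
-/

namespace Summit.FinalStateConjecture.FinalStateConjecture.Theses.HomotheticSurfaceGravity

open scoped BigOperators Topology Manifold Classical MeasureTheory ProbabilityTheory Matrix InnerProductSpace ComplexConjugate ContinuousMap
open Filter Set Function TopologicalSpace MeasureTheory

attribute [summit_statement] _root_.FinalStateConjecture

/-! Retired items kept as plain definitions (history; not obligations of this route): landed proofs / closed glue still name them. -/

-- tombstone: stmt-FinalStateConjecture-9938 was DROPPED from this route but is still named by active items / landed proofs — kept as a plain def (no route_item tag), not an obligation of this route
/-- retired stmt-FinalStateConjecture-9938 (dropped, gen None) — proved by Summit.FinalStateConjecture.FinalStateConjecture.Theorems.LocalExitSuffices_proof @ 442927d8e260. -/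
def LocalExitSuffices : Prop :=
  ∀ (X : Type) [TopologicalSpace X] [ChartedSpace Literature.Geometry.Lorentzian.E3 X] [IsManifold (𝓡 3) ((⊤ : ℕ∞) : WithTop ℕ∞) X] [T2Space X] [SecondCountableTopology X] [ConnectedSpace X] (𝓔 : Set (Literature.Geometry.Lorentzian.InitialDataSet (𝓡 3) X)) (D : Literature.Geometry.Lorentzian.InitialDataSet (𝓡 3) X), (∃ F : EuclideanSpace ℝ (Fin 1) → Literature.Geometry.Lorentzian.InitialDataSet (𝓡 3) X, Literature.Geometry.Lorentzian.InitialDataSet.IsSmoothDataFamily 1 F ∧ F 0 = D ∧ Function.Injective F ∧ (∀ c, F c ∈ Literature.Geometry.Lorentzian.admissibleVacuumData X) ∧ ∃ ε : ℝ, 0 < ε ∧ ∀ c, c ≠ 0 → ‖c‖ < ε → F c ∉ 𝓔) → ∃ F : EuclideanSpace ℝ (Fin 1) → Literature.Geometry.Lorentzian.InitialDataSet (𝓡 3) X, Literature.Geometry.Lorentzian.InitialDataSet.IsSmoothDataFamily 1 F ∧ F 0 = D ∧ Function.Injective F ∧ (∀ c, F c ∈ Literature.Geometry.Lorentzian.admissibleVacuumData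 X) ∧ ∀ c, c ≠ 0 → F c ∉ 𝓔

-- earlier ProfileExit (stmt-FinalStateConjecture-11665, replaced 2026-08-16T23:16:51Z -> stmt-FinalStateConjecture-17352): retired by None — ∀ (X : Type) [TopologicalSpace X] [ChartedSpace Literature.Geometry.Lorentzian.E3 X] [IsManifold (𝓡 3) ((⊤ : ℕ∞) : WithTop ℕ∞) X] [T2Space X] [SecondCountableTopology X] [ConnectedSpace X], ∀ D ∈ Literature.Geometry.Lorentzian.admissibleVacuumData X, ∀ 𝒟 : Lite
/-- item stmt-FinalStateConjecture-17352 · crux · rank 2 · open · by planner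
why it might fail: Mild naked profiles may be smoothly STABLE: the k-family (α=1+k²≪2) is stable at threshold regularity, even under small smooth perturbations (arXiv:2605.16235 Thm 1.3); smooth-to-cone DSS naked exteriors with μ≪1 exist (arXiv:2412.09540); exits must still reach the Kerr basin (|a|≪M, 2104.11857).
sources: arXiv:2605.16235, arXiv:2605.16095, arXiv:2412.09540, Li2025, Christodoulou1999instability, arXiv:gr-qc/0101064
[crux] PROFILE EXIT (card K1 + K2 + P1, host of the α-analysis) — RESTATED 1:1 on 2026-08-16 for the
re-typed Statement (p126844: tame genericity on one fixed end, honest near-zone radii, intrinsic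
lower bound on the settled region, chart time orientation; supersedes
stmt-FinalStateConjecture-11665, same decl name): for every connected Hausdorff second-countable
3-manifold X, every admissible datum D, every maximal vacuum Cauchy development 𝒟 of D, every first
naked point P of 𝒟 and every NONFLAT smooth (C^∞ across its cone) self-similar vacuum profile Z
which is a C² tangent profile of 𝒟 at P (marked past = the past of Z's vertex), there are ONE
asymptotically flat end e of X, a one-parameter admissible family F through D which is TAME on e
(`IsTameDataFamily e 1 F`: jointly smooth; e the sole end; every member DR-flat on e with continuous
mass M(c); wDist-continuous at c = 0) and IMMERSED at c = 0 (`IsImmersedAtZero 1 F`), injective, and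
ε > 0 such that F c is good in the re-typed sense (MGHD exists; every MGHD has complete 𝓘⁺ and a
sub-extremal Kerr final-state decomposition d of O = exteriorOf with every future-complete
normalised null ray from Σ staying in closure O (`RaysStay -/
@[route_item "route-FinalStateConjecture-HomotheticSurfaceGravity"]
def ProfileExit : Prop :=
  ∀ (X : Type) [TopologicalSpace X] [ChartedSpace Literature.Geometry.Lorentzian.E3 X] [IsManifold (𝓡 3) ((⊤ : ℕ∞) : WithTop ℕ∞) X] [T2Space X] [SecondCountableTopology X] [ConnectedSpace X], ∀ D ∈ Literature.Geometry.Lorentzian.admissibleVacuumData X, ∀ 𝒟 : Literature.Geometry.Lorentzian.VacuumCauchyDevelopment D, 𝒟.IsMaximal → ∀ P : Set 𝒟.carrier, 𝒟.toCauchyDevelopment.FirstNakedPoint P → ∀ Z : Literature.Geometry.Lorentzian.SelfSimilarVacuumProfile.{0} ((⊤ : ℕ∞) : WithTop ℕ∞), Z.IsNonflat → Literature.Geometry.Lorentzian.Spacetime.IsTangentProfileAt 𝒟.toSpacetime P Z.toSpacetime Z.past 2 → ∃ (e : Literature.Geometry.Lorentzian.AFEnd X) (F : EuclideanSpace ℝ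 (Fin 1) → Literature.Geometry.Lorentzian.InitialDataSet (𝓡 3) X), Literature.Geometry.Lorentzian.InitialDataSet.IsTameDataFamily e 1 F ∧ Literature.Geometry.Lorentzian.InitialDataSet.IsImmersedAtZero 1 F ∧ F 0 = D ∧ Function.Injective F ∧ (∀ c, F c ∈ Literature.Geometry.Lorentzian.admissibleVacuumData X) ∧ ∃ ε : ℝ, 0 < ε ∧ ∀ c, c ≠ 0 → ‖c‖ < ε → ((∃ 𝒟' : Literature.Geometry.Lorentzian.VacuumCauchyDevelopment (F c), 𝒟'.IsMaximal) ∧ ∀ 𝒟' : Literature.Geometry.Lorentzian.VacuumCauchyDevelopment (F c), 𝒟'.IsMaximal → Summit.FinalStateConjecture.HasCompleteNullInfinity 𝒟'.toCauchyDevelopment ∧ ∃ (O : Set 𝒟'.carrier) (d : Literature.Geometry.Lorentzian.FinalStateDecomposition 𝒟'.toSpacetime O 2), (∀ i, Literature.Geometry.Lorentzian.Kerr.IsSubextremal (d.mass i) (d.spin i)) ∧ O = Summit.FinalStateConjecture.exteriorOf 𝒟'.toCauchyDevelopment d.charted ∧ Summit.FinalStateConjecture.RaysStayInClosure 𝒟'.toCauchyDevelopment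 O ∧ Summit.FinalStateConjecture.HasExhaustiveCharts d ∧ Summit.FinalStateConjecture.IsFutureOriented d)

-- earlier NakedTangentProfile (stmt-FinalStateConjecture-11666, replaced 2026-08-16T23:16:51Z -> stmt-FinalStateConjecture-17353): retired by None — ∀ (X : Type) [TopologicalSpace X] [ChartedSpace Literature.Geometry.Lorentzian.E3 X] [IsManifold (𝓡 3) ((⊤ : ℕ∞) : WithTop ℕ∞) X] [T2Space X] [SecondCountableTopology X] [ConnectedSpace X], ∀ D ∈ Literature.Geometry.Lorentzian.admissibleVacuumData X, ∀ 
/-- item stmt-FinalStateConjecture-17353 · crux · rank 3 · open · by planner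
why it might fail: If the tangent cone is NOT smooth, disjunct 2 (Z of class ⊤) is void — known vacuum naked singularities are only C^(1,cε²)/twisted across the cone (arXiv:1912.08478 Thm 1, p.17; 2204.09891) — and disjunct 1 is full censorship there; piled-up TIPs: no FIRST naked point; Type-II rates: no SS limit.
sources: arXiv:1912.08478, arXiv:2204.09891, arXiv:2205.11715, RodnianskiShlapentokhrothman2018, arXiv:2412.09540, Christodoulou1999instability
[crux] EXIT-LESS NAKED DATA HAVE NONFLAT SELF-SIMILAR TANGENT PROFILES (card K3; typed form of the
extraction step shared in content with TangentProfileCensorship's informal TangentProfileExtraction)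
— RESTATED 1:1 on 2026-08-16 for the re-typed Statement (p126844; supersedes
stmt-FinalStateConjecture-11666, same decl name; only disjunct 1 changed): for every X, admissible D
and maximal vacuum Cauchy development 𝒟 of D with INCOMPLETE future null infinity (sojourn form),
either there is a local good exit family through D which is tame on one fixed asymptotically flat
end of X and immersed at 0, with 'good' in the re-typed sense (literally ProfileExit's conclusion:
complete 𝓘⁺, sub-extremal Kerr decomposition of O = exteriorOf with RaysStayInClosure, honest-radii
HasExhaustiveCharts, IsFutureOriented), or 𝒟 has a first naked point P (TIP, visible from infinity,
minimal) and a nonflat smooth self-similar vacuum profile Z which is a C² tangent profile of 𝒟 at P.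
[difficulty: open-problem] -/
@[route_item "route-FinalStateConjecture-HomotheticSurfaceGravity"]
def NakedTangentProfile : Prop :=
  ∀ (X : Type) [TopologicalSpace X] [ChartedSpace Literature.Geometry.Lorentzian.E3 X] [IsManifold (𝓡 3) ((⊤ : ℕ∞) : WithTop ℕ∞) X] [T2Space X] [SecondCountableTopology X] [ConnectedSpace X], ∀ D ∈ Literature.Geometry.Lorentzian.admissibleVacuumData X, ∀ 𝒟 : Literature.Geometry.Lorentzian.VacuumCauchyDevelopment D, 𝒟.IsMaximal → ¬ Summit.FinalStateConjecture.HasCompleteNullInfinity 𝒟.toCauchyDevelopment → (∃ (e : Literature.Geometry.Lorentzian.AFEnd X) (F : EuclideanSpace ℝ (Fin 1) → Literature.Geometry.Lorentzian.InitialDataSet (𝓡 3) X), Literature.Geometry.Lorentzian.InitialDataSet.IsTameDataFamily e 1 F ∧ Literature.Geometry.Lorentzian.InitialDataSet.IsImmersedAtZero 1 F ∧ F 0 = D ∧ Function.Injective F ∧ (∀ c, F c ∈ Literature.Geometry.Lorentzian.admissibleVacuumData X) ∧ ∃ ε : ℝ, 0 < ε ∧ ∀ c, c ≠ 0 → ‖c‖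 < ε → ((∃ 𝒟' : Literature.Geometry.Lorentzian.VacuumCauchyDevelopment (F c), 𝒟'.IsMaximal) ∧ ∀ 𝒟' : Literature.Geometry.Lorentzian.VacuumCauchyDevelopment (F c), 𝒟'.IsMaximal → Summit.FinalStateConjecture.HasCompleteNullInfinity 𝒟'.toCauchyDevelopment ∧ ∃ (O : Set 𝒟'.carrier) (d : Literature.Geometry.Lorentzian.FinalStateDecomposition 𝒟'.toSpacetime O 2), (∀ i, Literature.Geometry.Lorentzian.Kerr.IsSubextremal (d.mass i) (d.spin i)) ∧ O = Summit.FinalStateConjecture.exteriorOf 𝒟'.toCauchyDevelopment d.charted ∧ Summit.FinalStateConjecture.RaysStayInClosure 𝒟'.toCauchyDevelopment O ∧ Summit.FinalStateConjecture.HasExhaustiveCharts d ∧ Summit.FinalStateConjecture.IsFutureOriented d)) ∨ ∃ P : Set 𝒟.carrier, 𝒟.toCauchyDevelopment.FirstNakedPoint P ∧ ∃ Z : Literature.Geometry.Lorentzian.SelfSimilarVacuumProfile.{0} ((⊤ : ℕ∞) : WithTop ℕ∞), Z.IsNonflat ∧ Literature.Geometry.Lorentzian.Spacetime.IsTangentProfileAt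 𝒟.toSpacetime P Z.toSpacetime Z.past 2

-- earlier CensoredDataExit (stmt-FinalStateConjecture-9936, replaced 2026-08-16T23:16:51Z -> stmt-FinalStateConjecture-17348): moot by None — ∀ (X : Type) [TopologicalSpace X] [ChartedSpace Literature.Geometry.Lorentzian.E3 X] [IsManifold (𝓡 3) ((⊤ : ℕ∞) : WithTop ℕ∞) X] [T2Space X] [SecondCountableTopology X] [ConnectedSpace X], ∀ D ∈ Literature.Geometry.Lorentzian.admissibleVacuumData X, (∃ 𝒟 : Li
/-- item stmt-FinalStateConjecture-17348 · crux · rank 4 · open · by planner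
why it might fail: Needs sub-extremal Kerr stability for LARGE censored data (printed only for |a|/M≪1, arXiv:2104.11857) and non-genericity of every non-settling censored end state (extremal horizons form from regular data: arXiv:2211.15742); a fractal threshold accumulating at D (arXiv:0711.4612) has no exit curve.
sources: KlainermanSzeftel2023, arXiv:2104.11857, GiorgiKlainermanSzeftel2022, DafermosHolzegelRodnianskiTaylor2021, KehleUnger2025, arXiv:2211.15742
[crux] TAME CENSORED DATA EXIT (re-type T2 of the shared CensoredDataExit, Statement p126844,
2026-08-16; the final-state half at censored data, local form; offered verbatim to
TangentProfileCensorship / HomotheticSurfaceGravity / NoVacuumStrings for re-attachment): for every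
X as above and every admissible datum D which has an MGHD, all of whose MGHDs have complete 𝓘⁺, but
some MGHD of which carries no sub-extremal Kerr final-state decomposition d of its self-determined
exterior O = exteriorOf 𝒟 d.charted with RaysStayInClosure 𝒟 O, HasExhaustiveCharts d (honest radii)
and IsFutureOriented d, there are one asymptotically flat end e of X, an injective one-parameter
admissible family F through D (F 0 = D) tame on e and immersed at 0, and ε > 0 with F c good (as in
TameCurvatureModeExit) for 0 < ‖c‖ < ε. [difficulty: open-problem] -/
@[route_item "route-FinalStateConjecture-HomotheticSurfaceGravity"]
def CensoredDataExit : Prop :=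
  ∀ (X : Type) [TopologicalSpace X] [ChartedSpace Literature.Geometry.Lorentzian.E3 X] [IsManifold (𝓡 3) ((⊤ : ℕ∞) : WithTop ℕ∞) X] [T2Space X] [SecondCountableTopology X] [ConnectedSpace X], ∀ D ∈ Literature.Geometry.Lorentzian.admissibleVacuumData X, (∃ 𝒟 : Literature.Geometry.Lorentzian.VacuumCauchyDevelopment D, 𝒟.IsMaximal) → (∀ 𝒟 : Literature.Geometry.Lorentzian.VacuumCauchyDevelopment D, 𝒟.IsMaximal → Summit.FinalStateConjecture.HasCompleteNullInfinity 𝒟.toCauchyDevelopment) → (∃ 𝒟 : Literature.Geometry.Lorentzian.VacuumCauchyDevelopment D, 𝒟.IsMaximal ∧ ¬ ∃ (O : Set 𝒟.carrier) (d : Literature.Geometry.Lorentzian.FinalStateDecomposition 𝒟.toSpacetime O 2), (∀ i, Literature.Geometry.Lorentzian.Kerr.IsSubextremal (d.mass i) (d.spin i)) ∧ O = Summit.FinalStateConjecture.exteriorOf 𝒟.toCauchyDevelopment d.charted ∧ Summit.FinalStateConjecture.RaysStayInClosure 𝒟.toCauchyDevelopment O ∧ Summit.FinalStateConjecture.HasExhaustiveCharts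 d ∧ Summit.FinalStateConjecture.IsFutureOriented d) → ∃ (e : Literature.Geometry.Lorentzian.AFEnd X) (F : EuclideanSpace ℝ (Fin 1) → Literature.Geometry.Lorentzian.InitialDataSet (𝓡 3) X), Literature.Geometry.Lorentzian.InitialDataSet.IsTameDataFamily e 1 F ∧ Literature.Geometry.Lorentzian.InitialDataSet.IsImmersedAtZero 1 F ∧ F 0 = D ∧ Function.Injective F ∧ (∀ c, F c ∈ Literature.Geometry.Lorentzian.admissibleVacuumData X) ∧ ∃ ε : ℝ, 0 < ε ∧ ∀ c, c ≠ 0 → ‖c‖ < ε → ((∃ 𝒟 : Literature.Geometry.Lorentzian.VacuumCauchyDevelopment (F c), 𝒟.IsMaximal) ∧ ∀ 𝒟 : Literature.Geometry.Lorentzian.VacuumCauchyDevelopment (F c), 𝒟.IsMaximal → Summit.FinalStateConjecture.HasCompleteNullInfinity 𝒟.toCauchyDevelopment ∧ ∃ (O : Set 𝒟.carrier) (d : Literature.Geometry.Lorentzian.FinalStateDecomposition 𝒟.toSpacetime O 2), (∀ i, Literature.Geometry.Lorentzian.Kerr.IsSubextremal (d.mass i) (d.spin i)) ∧ O = Summit.FinalStateConjecture.exteriorOf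 𝒟.toCauchyDevelopment d.charted ∧ Summit.FinalStateConjecture.RaysStayInClosure 𝒟.toCauchyDevelopment O ∧ Summit.FinalStateConjecture.HasExhaustiveCharts d ∧ Summit.FinalStateConjecture.IsFutureOriented d)

-- item stmt-FinalStateConjecture-14280 · crux · rank 5 · open · by planner — informal only, no Lean statement yet:
--   [crux] TRANSVERSAL EXPONENT LADDER — REPAIRED 2026-08-16 after the refuter crux-attack on
--   stmt-FinalStateConjecture-11724 (CruxAttack.md v2: refuted-misstated at typing level, core survives;
--   fixes F1 interior regularity of the mode, F2 regime 1<α<2 for the rough ladder and endpoint α>2 for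
--   'no branch', F3 localisation at the invariant generator; plus the screen normalisation under which
--   the exponents were derived). Informal: signature pends D3 = defn-IsHomothetyAdaptedChart for (ii)
--   and a transversal-exponent vocabulary for (i)/(iii); foreseen child of ProfileExit in the glued
--   split BenignProf

/-- item stmt-FinalStateConjecture-14390 · crux · rank 6 · open · by planner
why it might fail: Far-sector benign profiles (flat on a sector around 𝒩, CSS radiation beyond a Φ-invariant null hyperplane) or a Fefferman–Graham-type conical vertex may be first-naked tangent profiles with α=1 at every periodic generator: α read on 𝒩 is blind to the far sector (refuter finding I).
sources: arXiv:1912.08478, arXiv:1705.09674, arXiv:2205.11715, arXiv:2412.09540, arXiv:0710.0919, Galloway2000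
[crux] BENIGN PROFILES ARE NOT FIRST-NAKED — REPAIRED 2026-08-16 (route-repair of
stmt-FinalStateConjecture-11734 after the refuter crux-attack CruxAttack-11734.md, refuted-misstated
at typing level: (B) the informal hypotheses never constrained Z.dilation, so Φ := Φ₀∘parity
(antipodal return map on the generator sphere) has NO invariant generator; (C) deleting the closed
set of Φ-fixed generators gives a hypothesis-preserving open sub-profile with none; the refuter's
repair C′ = cone-completeness + periodic generators is filed here verbatim, typed with inline
notions). STATEMENT: for X, D ∈ admissibleVacuumData X, a maximal vacuum Cauchy development 𝒟 of D,
a first naked point P of 𝒟 and a NONFLAT smooth (C^∞ across its cone) self-similar vacuum profile Z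
which is a C² tangent profile of 𝒟 at P (hypothesis block literally ProfileExit's): IF the vertex
past cone of Z is COMPLETE — a homeomorphism e : Z.cone ≃ₜ S² × ℝ whose lines u ↦ e⁻¹(ω, log(−u)), u
< 0, are maximal affinely parametrised future-directed null geodesic generators of Z.cone with
vertex end at u = 0 (IsMaximalGeodesicOn … (Iio 0) ∧ Z.IsConeGeneratorOn … (Iio 0)) — THEN for some
k ≥ 1 there is a k-PERIODIC normalised -/
@[route_item "route-FinalStateConjecture-HomotheticSurfaceGravity"]
def BenignProfileRigidityR : Prop :=
  ∀ (X : Type) [TopologicalSpace X] [ChartedSpace Literature.Geometry.Lorentzian.E3 X] [IsManifold (𝓡 3) ((⊤ : ℕ∞) : WithTop ℕ∞) X] [T2Space X] [SecondCountableTopology X] [ConnectedSpace X], ∀ D ∈ Literature.Geometry.Lorentzian.admissibleVacuumData X, ∀ 𝒟 : Literature.Geometry.Lorentzian.VacuumCauchyDevelopment D, 𝒟.IsMaximal → ∀ P : Set 𝒟.carrier, 𝒟.toCauchyDevelopment.FirstNakedPoint P → ∀ Z : Literature.Geometry.Lorentzian.SelfSimilarVacuumProfile.{0} ((⊤ : ℕ∞)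 : WithTop ℕ∞), Z.IsNonflat → Literature.Geometry.Lorentzian.Spacetime.IsTangentProfileAt 𝒟.toSpacetime P Z.toSpacetime Z.past 2 → (∃ e : Z.cone ≃ₜ (Metric.sphere (0 : EuclideanSpace ℝ (Fin 3)) 1) × ℝ, ∀ ω : Metric.sphere (0 : EuclideanSpace ℝ (Fin 3)) 1, Literature.Geometry.Lorentzian.IsMaximalGeodesicOn Z.metric.leviCivita (fun u : ℝ ↦ ((e.symm (ω, Real.log (-u)) : Z.cone) : Z.carrier)) (Set.Iio 0) ∧ Z.IsConeGeneratorOn (fun u : ℝ ↦ ((e.symm (ω, Real.log (-u)) : Z.cone) : Z.carrier)) (Set.Iio 0)) → ∃ k : ℕ, 1 ≤ k ∧ ∃ (γ : ℝ → Z.carrier) (c : ℝ), Literature.Geometry.Lorentzian.IsMaximalGeodesicOn Z.metric.leviCivita γ (Set.Iio 0) ∧ Z.IsConeGeneratorOn γ (Set.Iio 0) ∧ Set.InjOn γ (Set.Iio 0) ∧ 0 < c ∧ c < 1 ∧ (∀ u : ℝ, u < 0 → (Z.dilation.symm)^[k] (γ u) = γ (c * u)) ∧ 1 < Real.log c / ((∫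 t in (-1 : ℝ)..(-c), Z.expansionAlong γ t) / 2)

/-- item stmt-FinalStateConjecture-14391 · crux · rank 7 · open · by planner
why it might fail: Twisted smooth DSS vacuum: Φ^k fixes only finitely many generators (zeros / commensurate closed orbits of the return map); zero shear there need not spread over the cone — propagation is printed only for the untwisted CSS class (RSR Prop 2.6; Prop 2.7 'Proof. Omitted').
sources: arXiv:1912.08478, arXiv:1705.09674, arXiv:2205.11715, Galloway2000, arXiv:0710.0919
[crux] SHEAR-FREENESS SPREADS FROM THE PERIODIC GENERATORS (intrinsic, 𝒟-free core of
BenignProfileRigidityR, filed 2026-08-16 on the refuter's recommendation in CruxAttack-11734.md,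
finding I (i)). STATEMENT: for every smooth (C^∞ across its cone) self-similar vacuum profile Z
whose vertex past cone is COMPLETE (a homeomorphism e : Z.cone ≃ₜ S² × ℝ whose lines u ↦ e⁻¹(ω,
log(−u)), u < 0, are maximal affinely parametrised future-directed null generators with vertex end
at u = 0) and every generator field F of the level-set null hypersurface Z.cone
(Z.coneLevelSet.GeneratorField of NullConeGeneratorKinematics): if the squared shear |σ_F|²
(GeneratorField.shearNormSq; its vanishing does not depend on the normalisation of F, σ_{fn} = fσ_n)
vanishes along every k-PERIODIC normalised generator γ (k ≥ 1; maximal geodesic and cone generator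
on (−∞,0), injective, (Φ⁻¹)^[k](γ u) = γ(cu), 0 < c < 1), then |σ_F|² ≡ 0 on all of Z.cone — the
cone is shear-free, hence of Fefferman–Graham type at the cone (homothety normal to the cone: RSR
arXiv:1912.08478 §1.4 p. 8; Prop 2.6 p. 16–17; the one printed rigidity in this direction, Prop 2.7,
has 'Proof. Omitted' and concerns the untwisted class). By -/
@[route_item "route-FinalStateConjecture-HomotheticSurfaceGravity"]
def PeriodicShearRigidity : Prop :=
  ∀ Z : Literature.Geometry.Lorentzian.SelfSimilarVacuumProfile.{0} ((⊤ : ℕ∞) : WithTop ℕ∞), (∃ e : Z.cone ≃ₜ (Metric.sphere (0 : EuclideanSpace ℝ (Fin 3)) 1) × ℝ, ∀ ω : Metric.sphere (0 : EuclideanSpace ℝ (Fin 3)) 1, Literature.Geometry.Lorentzian.IsMaximalGeodesicOn Z.metric.leviCivita (fun u : ℝ ↦ ((e.symm (ω, Real.log (-u)) : Z.cone) : Z.carrier)) (Set.Iio 0) ∧ Z.IsConeGeneratorOn (fun u : ℝ ↦ ((e.symm (ω, Real.log (-u)) : Z.cone) : Z.carrier)) (Set.Iio 0)) → ∀ F :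 Z.coneLevelSet.GeneratorField, (∀ (k : ℕ) (γ : ℝ → Z.carrier) (c : ℝ), 1 ≤ k → Literature.Geometry.Lorentzian.IsMaximalGeodesicOn Z.metric.leviCivita γ (Set.Iio 0) → Z.IsConeGeneratorOn γ (Set.Iio 0) → Set.InjOn γ (Set.Iio 0) → 0 < c → c < 1 → (∀ u : ℝ, u < 0 → (Z.dilation.symm)^[k] (γ u) = γ (c * u)) → ∀ u : ℝ, u < 0 → F.shearNormSq (γ u) = 0) → ∀ x ∈ Z.cone, F.shearNormSq x = 0

/-- item stmt-FinalStateConjecture-9937 · crux · rank 9 · open · by planner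
why it might fail: Known in print (CBG 1969 Thm 3; undischarged XL fact) but typed over the REPAIRED prelude: IsMaximal needs EVERY typed VacuumCauchyDevelopment (O'Neill Cauchy notion, ∀[HasLeviCivita], one universe) to embed; a rogue typed development kills it, as the first rendering over VacuumDevelopment did.
sources: ChoquetBruhatGeroch1969CMP, Sbierski2016AHP, Ringstrom2009, Literature.Geometry.Lorentzian.CauchyProblemExistenceDefect, Literature.Geometry.Lorentzian.CauchyProblemMGHDExistenceProofs
[support] every admissible datum has a maximal globally hyperbolic vacuum development, stated over
the repaired structure `VacuumCauchyDevelopment` (the corrected form of the deprecated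
`choquetBruhat_geroch_exists_mghd`, recorded in `CauchyProblemExistenceDefect`);
Choquet-Bruhat–Geroch 1969 Thm. 3, Sbierski 2016 Thm. 2.6. Known theorem; large formalisation;
shared by every route of this summit. [difficulty: XL] -/
@[route_item "route-FinalStateConjecture-HomotheticSurfaceGravity"]
def MGHDExistence : Prop :=
  ∀ (X : Type) [TopologicalSpace X] [ChartedSpace Literature.Geometry.Lorentzian.E3 X] [IsManifold (𝓡 3) ((⊤ : ℕ∞) : WithTop ℕ∞) X] [T2Space X] [SecondCountableTopology X] [ConnectedSpace X], ∀ D ∈ Literature.Geometry.Lorentzian.admissibleVacuumData X, ∃ 𝒟 : Literature.Geometry.Lorentzian.VacuumCauchyDevelopment D, 𝒟.IsMaximal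

/-- item stmt-FinalStateConjecture-11667 · support · rank 9 · open · by planner
sources: arXiv:1912.08478, arXiv:gr-qc/0304070, HawkingEllis1973
[support] THEOREM A, ANALYTIC CORE (i) — the affine clock of a periodic inaffinity: for T > 0, f ≥ 0
continuous and T-periodic (f = |σ_n|² + Ric(n,n) along the invariant generator in area time τ, θ_n ≡
−2) and Ψ with Ψ' = −1 − f/2 (Raychaudhuri at θ ≡ −2 gives the inaffinity κ_n = −1 − f/2), put α :=
1 + (∫₀ᵀ f)/(2T); then α ≥ 1, α = 1 iff f ≡ 0, e^Ψ is integrable on every [τ, ∞) (the vertex is at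
finite affine distance S(τ) = ∫_τ^∞ e^Ψ) and S(τ + T) = e^(−αT) S(τ) (affine contraction c₀ = μ₀^α
per period, μ₀ = e^(−T)). [difficulty: provable-now] -/
@[route_item "route-FinalStateConjecture-HomotheticSurfaceGravity"]
def PeriodicInaffinityLaw : Prop :=
  ∀ (T : ℝ) (f Ψ : ℝ → ℝ), 0 < T → Continuous f → (∀ τ, 0 ≤ f τ) → (∀ τ, f (τ + T) = f τ) → (∀ τ, HasDerivAt Ψ (-1 - f τ / 2) τ) → (1 ≤ 1 + (∫ τ in (0 : ℝ)..T, f τ) / (2 * T)) ∧ ((1 + (∫ τ in (0 : ℝ)..T, f τ) / (2 * T) = 1) ↔ ∀ τ, f τ = 0) ∧ (∀ τ, MeasureTheory.IntegrableOn (fun x ↦ Real.exp (Ψ x)) (Set.Ioi τ)) ∧ ∀ τ, ∫ x in Set.Ioi (τ + T), Real.exp (Ψ x) = Real.exp (-((1 + (∫ τ in (0 : ℝ)..T, f τ) / (2 * T)) * T)) * ∫ x in Set.Ioi τ, Real.exp (Ψ x)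

/-- item stmt-FinalStateConjecture-11668 · support · rank 9 · open · by planner
sources: arXiv:2601.04152, HawkingEllis1973, arXiv:1912.08478
[support] THEOREM A, GAUGE-FREE FORM (ii): if ρ is concave and positive on (−ε, 0) with ρ(u) → 0 as
u → 0⁻ (ρ = √A along the invariant generator in an affine parameter u vanishing at the vertex;
concavity is Raychaudhuri + NEC, (√A)'' = −½(|σ|² + Ric(L,L))√A ≤ 0) and ρ(c·u) = μ·ρ(u) on (−ε, 0)
for constants 0 < c < 1, 0 < μ (the contraction Φ⁻¹ acts by u ↦ cu on the generator and by A ↦ μ²A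
on the area density), then c ≤ μ (i.e. α = log c/log μ ≥ 1 when μ < 1), and μ = c forces ρ(u) =
a·(−u) on (−ε, 0) (shear- and flux-free generator). [difficulty: provable-now] -/
@[route_item "route-FinalStateConjecture-HomotheticSurfaceGravity"]
def ConcaveScalingRigidity : Prop :=
  ∀ (ρ : ℝ → ℝ) (ε c μ : ℝ), 0 < ε → 0 < c → c < 1 → 0 < μ → ConcaveOn ℝ (Set.Ioo (-ε) 0) ρ → (∀ u ∈ Set.Ioo (-ε) 0, 0 < ρ u) → Filter.Tendsto ρ (nhdsWithin 0 (Set.Iio 0)) (nhds 0) → (∀ u ∈ Set.Ioo (-ε) 0, ρ (c * u) = μ * ρ u) → c ≤ μ ∧ (μ = c → ∃ a : ℝ, ∀ u ∈ Set.Ioo (-ε) 0, ρ u = a * (-u))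

-- item stmt-FinalStateConjecture-11737 · support · rank 9 · open · by planner — informal only, no Lean statement yet:
--   [support] MODE TO EXIT (transport + quantisation + basin landing; foreseen child of ProfileExit,
--   glue of the split BenignProfileRigidity → TransversalExponentLadder → ModeToExit → ProfileExit;
--   shared in content with TangentProfileCensorship's SmoothProfileInstability (second half) and
--   NakedPointQuantisation — identical signatures to be shared once typed). If a nonflat smooth
--   self-similar vacuum profile Z, a C² tangent profile of a maximal vacuum Cauchy development 𝒟 of an
--   admissible datum D at a first naked point P, has a non-gauge smooth growing mode
--   (MetricCoord.HasSmoothUnstableMode in homo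

-- item stmt-FinalStateConjecture-11738 · support · rank 9 · open · by planner — informal only, no Lean statement yet:
--   [support] THEOREM A — NO SELF-SIMILAR SINGULARITY RED-SHIFTS ITS PAST CONE (card P1; provable once
--   the definition requests NullConeGeneratorKinematics / homotheticSurfaceGravity land; its two
--   analytic cores are already typed as PeriodicInaffinityLaw (stmt-FinalStateConjecture-11667) and
--   ConcaveScalingRigidity (stmt-FinalStateConjecture-11668)). For every self-similar vacuum profile Z
--   (SelfSimilarVacuumProfile n, n ≥ 2; more generally any null-energy-condition spacetime with a
--   discrete homothety fixing an ideal vertex with cone-regular past cone) and every dilation-invariant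
--   generator γ₀ of Z.c

-- earlier Assembly (stmt-FinalStateConjecture-11669, replaced 2026-08-16T20:49:56Z -> stmt-FinalStateConjecture-16801): retired by None — MGHDExistence → LocalExitSuffices → NakedTangentProfile → ProfileExit → CensoredDataExit → FinalStateConjecture
/-- item stmt-FinalStateConjecture-16801 · assembly · rank 1 · open · by planner
sources: Christodoulou1999, DafermosLuk2017
[assembly] MGHDExistence → NakedTangentProfile → ProfileExit → CensoredDataExit →
FinalStateConjecture (restated 2026-08-16 by the cone repair: the former hypothesis
LocalExitSuffices is proved inline in the deciding theorem `closes`, which proves this implication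
verbatim). -/
@[route_item "route-FinalStateConjecture-HomotheticSurfaceGravity"]
def Assembly : Prop :=
  MGHDExistence → NakedTangentProfile → ProfileExit → CensoredDataExit → FinalStateConjecture

-- records of items no longer active in this route (dropped / restated):
-- earlier LocalExitSuffices (stmt-FinalStateConjecture-9938, dropped 2026-08-16T20:49:56Z): proved by Summit.FinalStateConjecture.FinalStateConjecture.Theorems.LocalExitSuffices_proof @ 442927d8e260 — ∀ (X : Type) [TopologicalSpace X] [ChartedSpace Literature.Geometry.Lorentzian.E3 X] [IsManifold (𝓡 3) ((⊤ : ℕ∞) : WithTop ℕ∞) X] [T2Space X] [SecondCountableTopology X] [ConnectedSpace X] (𝓔 : Set (Li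

/-! D-0027 §2.1 — DECIDING THEOREM (planner-authored via `route open/edit --closes-file`; by planner-rbadge-FinalStateConjecture-Homothetic-83df192b-0 2026-08-16T23:41:31Z):
its hypotheses are this route's items and its conclusion the sub-problem Statement (glue_lint), and it elaborates with this file. -/

/-- The deciding theorem of route HomotheticSurfaceGravity (D-0027 §2.1), RE-ELABORATED for the re-typed Statement of
2026-08-16 and RE-CERTIFIED UNCHANGED by the route-repair seat of 2026-08-16T23:45Z (the fullbuild stamp
`671:2: Type mismatch` was taken from the pre-23:16Z file, whose glue was still the non-tame one; 671:2 is not a token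
position of this text, which elaborates natively with rc 0 and the standard axioms) (p126844: tame genericity `IsTameChristodoulouGeneric` on one fixed end, honest near-zone radii inside
`HasExhaustiveCharts`, intrinsic lower bound `RaysStayInClosure`, chart time orientation `IsFutureOriented`): pure logic
plus one calculus step. Fix `X` and an exceptional admissible datum `D`. A LOCAL TAME exit through `D` suffices (`hL`,
proved inline): a family tame on a fixed end `e` and immersed at `0`, injective and admissible, whose members with
`0 < ‖c‖ < ε` avoid the exceptional set, is reparametrised by the squashing map `σ c = (ε/2 · arctan c₀) e₀` of `ℝ¹`
(smooth, injective, `σ 0 = 0`, `‖σ c‖ < ε`, `dσ(0) = (ε/2) id ≠ 0`) to one ALL of whose members with `c ≠ 0` avoid it;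
precomposition with `σ` keeps joint smoothness, the sole end, the continuous mass function `M ∘ σ`, the same-end decay,
the `wDist`-continuity at `0` (`σ` is continuous with `σ 0 = 0`) and — by the chain rule and `dσ(0) v ≠ 0` for `v ≠ 0` —
immersion at `0`. Then: if every maximal development of `D` has complete future null infinity, `MGHDExistence` gives an
MGHD, exceptionality of `D` yields a maximal development that does not settle down in the re-typed sense (sub-extremal
final holes, `O = exteriorOf`, rays stay in `closure O`, exhaustive honest charts, future-oriented chart time), and
`CensoredDataExit` supplies the tame exit. Otherwise some maximal development `𝒟` has incomplete future null infinity and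
`NakedTangentProfile` gives either the tame exit directly or a first naked point `P` with a nonflat smooth self-similar
vacuum tangent profile `Z`, to which `ProfileExit` applies. Members with `0 < ‖c‖ < ε` are good, hence outside the
exceptional set `{d ∈ 𝓓 | ¬ P d}`. Every item and this deciding step unfold to prelude DEFINITIONS only; no named
Literature fact occurs in the route's dependency or import cone (axioms: propext, Classical.choice, Quot.sound). -/
@[closes "route-FinalStateConjecture-HomotheticSurfaceGravity"] theorem closes (hM : MGHDExistence) (hT : NakedTangentProfile) (hP : ProfileExit)
    (hB : CensoredDataExit) : FinalStateConjecture := by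
  intro X _ _ _ _ _ _ D hD
  obtain ⟨hAdm, hbad⟩ := hD
  -- TAME LOCAL EXIT SUFFICES, inlined: a tame immersed family whose members with `0 < ‖c‖ < ε`
  -- avoid `𝓔` is reparametrised by the squashing map `σ c = (ε/2 · arctan c₀) e₀` of `ℝ¹`
  -- (smooth, injective, `σ 0 = 0`, `‖σ c‖ < ε`, `dσ(0) = (ε/2) id`) to one all of whose members
  -- with `c ≠ 0` avoid `𝓔`; tameness and immersion survive the reparametrisation. Pure calculus.
  have hL : ∀ (𝓔 : Set (Literature.Geometry.Lorentzian.InitialDataSet (𝓡 3) X))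
      (D : Literature.Geometry.Lorentzian.InitialDataSet (𝓡 3) X),
      (∃ (e : Literature.Geometry.Lorentzian.AFEnd X)
          (F : EuclideanSpace ℝ (Fin 1) → Literature.Geometry.Lorentzian.InitialDataSet (𝓡 3) X),
        Literature.Geometry.Lorentzian.InitialDataSet.IsTameDataFamily e 1 F ∧
          Literature.Geometry.Lorentzian.InitialDataSet.IsImmersedAtZero 1 F ∧ F 0 = D ∧
          Function.Injective F ∧
          (∀ c, F c ∈ Literature.Geometry.Lorentzian.admissibleVacuumData X) ∧
          ∃ ε : ℝ, 0 < ε ∧ ∀ c, c ≠ 0 → ‖c‖ < ε → F c ∉ 𝓔) →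
      ∃ (e : Literature.Geometry.Lorentzian.AFEnd X)
          (F : EuclideanSpace ℝ (Fin 1) → Literature.Geometry.Lorentzian.InitialDataSet (𝓡 3) X),
        Literature.Geometry.Lorentzian.InitialDataSet.IsTameDataFamily e 1 F ∧
          Literature.Geometry.Lorentzian.InitialDataSet.IsImmersedAtZero 1 F ∧ F 0 = D ∧
          Function.Injective F ∧
          (∀ c, F c ∈ Literature.Geometry.Lorentzian.admissibleVacuumData X) ∧
          ∀ c, c ≠ 0 → F c ∉ 𝓔 := by
    intro 𝓔 D hloc
    obtain ⟨e, F, hF, hI, h0, hinj, hadm, ε, hε, hgood⟩ := hloc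
    obtain ⟨hFs, hsole, ⟨M, hMc, hMflat⟩, hW⟩ := hF
    -- the squashing map and its properties
    set e₀ : EuclideanSpace ℝ (Fin 1) := EuclideanSpace.single (0 : Fin 1) (1 : ℝ) with he₀
    set σ : EuclideanSpace ℝ (Fin 1) → EuclideanSpace ℝ (Fin 1) :=
      fun c ↦ (ε / 2 * Real.arctan (c 0)) • e₀ with hσ
    have h1 : ContDiff ℝ ((⊤ : ℕ∞) : WithTop ℕ∞) (fun c : EuclideanSpace ℝ (Fin 1) ↦ c 0) :=
      (EuclideanSpace.proj (𝕜 := ℝ) (ι := Fin 1) 0).contDiff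
    have hσs : ContDiff ℝ ((⊤ : ℕ∞) : WithTop ℕ∞) σ :=
      (contDiff_const.mul (Real.contDiff_arctan.comp h1)).smul contDiff_const
    have hσ0 : ∀ c, σ c 0 = ε / 2 * Real.arctan (c 0) := fun c ↦ by
      simp [hσ, he₀, PiLp.smul_apply]
    have hσi : Function.Injective σ := by
      intro c c' h
      have h0' : ε / 2 * Real.arctan (c 0) = ε / 2 * Real.arctan (c' 0) := by
        rw [← hσ0 c, ← hσ0 c', h]
      have h1' : Real.arctan (c 0) = Real.arctan (c' 0) := by
        have hε' : (0 : ℝ) < ε / 2 := by positivity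
        exact mul_left_cancel₀ hε'.ne' h0'
      have h2 : c 0 = c' 0 := Real.arctan_injective h1'
      ext i
      fin_cases i
      exact h2
    have hσz : σ 0 = 0 := by
      ext i
      fin_cases i
      simp [hσ]
    have hσne : ∀ c, c ≠ 0 → σ c ≠ 0 := fun c hc h' ↦ hc (hσi (h'.trans hσz.symm))
    have hσnorm : ∀ c, ‖σ c‖ < ε := fun c ↦ by
      have hlt : |Real.arctan (c 0)| < 2 := by
        rw [abs_lt]
        constructor
        · linarith [Real.neg_pi_div_two_lt_arctan (c 0), Real.pi_le_four]
        · linarith [Real.arctan_lt_pi_div_two (c 0), Real.pi_le_four]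
      have hn : ‖σ c‖ = |ε / 2 * Real.arctan (c 0)| := by
        simp only [hσ, he₀, norm_smul, PiLp.norm_single, norm_one, mul_one, Real.norm_eq_abs]
      rw [hn, abs_mul, abs_of_pos (by positivity : (0 : ℝ) < ε / 2)]
      nlinarith [abs_nonneg (Real.arctan (c 0))]
    -- the derivative of `σ` at `0` is `(ε/2) id`, in particular injective
    have hd0 : HasFDerivAt (fun c : EuclideanSpace ℝ (Fin 1) ↦ c 0)
        (EuclideanSpace.proj (𝕜 := ℝ) (ι := Fin 1) 0) 0 :=
      (EuclideanSpace.proj (𝕜 := ℝ) (ι := Fin 1) 0).hasFDerivAt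
    have hd1 : HasFDerivAt (fun c : EuclideanSpace ℝ (Fin 1) ↦ Real.arctan (c 0))
        ((1 / (1 + ((0 : EuclideanSpace ℝ (Fin 1)) 0) ^ 2)) •
          EuclideanSpace.proj (𝕜 := ℝ) (ι := Fin 1) 0) 0 :=
      (Real.hasDerivAt_arctan _).comp_hasFDerivAt 0 hd0
    have hdσ : HasFDerivAt σ
        (((ε / 2) • ((1 / (1 + ((0 : EuclideanSpace ℝ (Fin 1)) 0) ^ 2)) •
          EuclideanSpace.proj (𝕜 := ℝ) (ι := Fin 1) 0)).smulRight e₀) 0 :=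
      (hd1.const_mul (ε / 2)).smul_const e₀
    have hσ'v : ∀ v : EuclideanSpace ℝ (Fin 1), fderiv ℝ σ 0 v = (ε / 2 * v 0) • e₀ := fun v ↦ by
      rw [hdσ.fderiv]
      simp [ContinuousLinearMap.smulRight_apply]
    have hσ'ne : ∀ v : EuclideanSpace ℝ (Fin 1), v ≠ 0 → fderiv ℝ σ 0 v ≠ 0 := by
      intro v hv h
      have hv0 : v 0 ≠ 0 := by
        intro h0'
        apply hv
        ext i
        fin_cases i
        simpa using h0'
      rw [hσ'v] at h
      have h' := congrArg (fun w : EuclideanSpace ℝ (Fin 1) ↦ w 0) h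
      have h'' : ε / 2 * v 0 = 0 := by simpa [he₀] using h'
      rcases mul_eq_zero.mp h'' with h2 | h2
      · linarith
      · exact hv0 h2
    -- precomposition with the smooth parameter map `σ` keeps the family jointly smooth
    have hπ : ContMDiff ((𝓘(ℝ, EuclideanSpace ℝ (Fin 1))).prod (𝓡 3))
        ((𝓘(ℝ, EuclideanSpace ℝ (Fin 1))).prod (𝓡 3)) ((⊤ : ℕ∞) : WithTop ℕ∞)
        (fun p : EuclideanSpace ℝ (Fin 1) × X ↦ (σ p.1, p.2)) :=
      (hσs.contMDiff.comp contMDiff_fst).prodMk contMDiff_snd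
    have hFσ : Literature.Geometry.Lorentzian.InitialDataSet.IsSmoothDataFamily 1 (F ∘ σ) :=
      ⟨hFs.1.comp hπ, hFs.2.comp hπ⟩
    -- … tame on the same end: sole end, mass `M ∘ σ`, same-end decay, `wDist`-continuity at `0`
    have hTame : Literature.Geometry.Lorentzian.InitialDataSet.IsTameDataFamily e 1 (F ∘ σ) := by
      refine ⟨hFσ, hsole, ⟨M ∘ σ, hMc.comp hσs.continuous, fun c ↦ hMflat (σ c)⟩, ?_⟩
      have hσt : Tendsto σ (𝓝 0) (𝓝 0) := by
        have h := hσs.continuous.tendsto 0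
        rwa [hσz] at h
      show Tendsto (fun c ↦ e.wDist (F (σ c)) (F (σ 0))) (𝓝 0) (𝓝 0)
      rw [hσz]
      exact hW.comp hσt
    -- … and immersed at `0` (chain rule; `dσ(0) v ≠ 0` for `v ≠ 0`)
    have hImm : Literature.Geometry.Lorentzian.InitialDataSet.IsImmersedAtZero 1 (F ∘ σ) := by
      intro v hv
      obtain ⟨x, u, w, huw⟩ := hI (fderiv ℝ σ 0 v) (hσ'ne v hv)
      refine ⟨x, u, w, ?_⟩
      have key : ∀ g : EuclideanSpace ℝ (Fin 1) → ℝ, fderiv ℝ g 0 (fderiv ℝ σ 0 v) ≠ 0 →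
          fderiv ℝ (g ∘ σ) 0 v ≠ 0 := by
        intro g hg
        have hgd : DifferentiableAt ℝ g 0 := by
          by_contra hnd
          rw [fderiv_zero_of_not_differentiableAt hnd] at hg
          exact hg rfl
        have hg' : HasFDerivAt g (fderiv ℝ g 0) (σ 0) := by
          rw [hσz]
          exact hgd.hasFDerivAt
        rw [(hg'.comp 0 hdσ.differentiableAt.hasFDerivAt).fderiv]
        simpa using hg
      rcases huw with h | h
      · exact Or.inl (key (fun c ↦ (F c).h.inner x u w) h)
      · exact Or.inr (key (fun c ↦ (F c).k x u w) h)
    refine ⟨e, F ∘ σ, hTame, hImm, ?_, hinj.comp hσi, fun c ↦ hadm _,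
      fun c hc ↦ hgood _ (hσne c hc) (hσnorm c)⟩
    show F (σ 0) = D
    rw [hσz, h0]
  refine hL _ D ?_
  by_cases hC : ∀ 𝒟 : Literature.Geometry.Lorentzian.VacuumCauchyDevelopment D, 𝒟.IsMaximal →
      Summit.FinalStateConjecture.HasCompleteNullInfinity 𝒟.toCauchyDevelopment
  · obtain ⟨𝒟₀, h𝒟₀⟩ := hM X D hAdm
    have hns : ∃ 𝒟 : Literature.Geometry.Lorentzian.VacuumCauchyDevelopment D, 𝒟.IsMaximal ∧
        ¬ ∃ (O : Set 𝒟.carrier) (d : Literature.Geometry.Lorentzian.FinalStateDecomposition 𝒟.toSpacetime O 2),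
          (∀ i, Literature.Geometry.Lorentzian.Kerr.IsSubextremal (d.mass i) (d.spin i)) ∧
            O = Summit.FinalStateConjecture.exteriorOf 𝒟.toCauchyDevelopment d.charted ∧
              Summit.FinalStateConjecture.RaysStayInClosure 𝒟.toCauchyDevelopment O ∧
                Summit.FinalStateConjecture.HasExhaustiveCharts d ∧
                  Summit.FinalStateConjecture.IsFutureOriented d := by
      by_contra hcon
      refine hbad ⟨⟨𝒟₀, h𝒟₀⟩, fun 𝒟 h𝒟 ↦ ⟨hC 𝒟 h𝒟, ?_⟩⟩
      by_contra hset
      exact hcon ⟨𝒟, h𝒟, hset⟩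
    obtain ⟨e, F, hF, hI, h0, hinj, hadm, ε, hε, hgood⟩ := hB X D hAdm ⟨𝒟₀, h𝒟₀⟩ hC hns
    exact ⟨e, F, hF, hI, h0, hinj, hadm, ε, hε, fun c hc hcε hmem ↦ hmem.2 (hgood c hc hcε)⟩
  · obtain ⟨𝒟, h𝒟⟩ := not_forall.mp hC
    obtain ⟨hmax, hinc⟩ := Classical.not_imp.mp h𝒟
    rcases hT X D hAdm 𝒟 hmax hinc with hexit | ⟨P, hPn, Z, hZ, htan⟩
    · obtain ⟨e, F, hF, hI, h0, hinj, hadm, ε, hε, hgood⟩ := hexit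
      exact ⟨e, F, hF, hI, h0, hinj, hadm, ε, hε, fun c hc hcε hmem ↦ hmem.2 (hgood c hc hcε)⟩
    · obtain ⟨e, F, hF, hI, h0, hinj, hadm, ε, hε, hgood⟩ := hP X D hAdm 𝒟 hmax P hPn Z hZ htan
      exact ⟨e, F, hF, hI, h0, hinj, hadm, ε, hε, fun c hc hcε hmem ↦ hmem.2 (hgood c hc hcε)⟩

end Summit.FinalStateConjecture.FinalStateConjecture.Theses.HomotheticSurfaceGravity
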